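import Mathlib.Algebra.BigOperators.Group.Finset.Basic
import Mathlib.Algebra.Order.BigOperators.Group.Finset
import Mathlib.Data.Fintype.Pi
import Mathlib.Data.Fintype.Powerset
import Mathlib.Data.Nat.Choose.Basic
import Mathlib.Data.Nat.Factorial.Basic
import Mathlib.InformationTheory.Hamming
import HarnessLib

/-!
# Binary Hamming balls: counting bounds and the packing/union estimate of Holmgren–Wein Lemma 1

Elementary counting on the Boolean cube `{0,1}^ι` (`ι → Bool`, Hamming distance = Mathlib's
`hammingDist`), for the barrier entry `Literature/Barriers/PneNP/LowDegreeCounterexamples.lean`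
(Holmgren–Wein 2021, Thm. 2), whose proof needs "a uniformly random string is far from every
codeword" (Lemma 1 there = LIPIcs Lemma 14): if the radius-`2r` Hamming balls around the points of
a set `𝒞` are pairwise disjoint, then
`P_x(∃ c ∈ 𝒞, Δ(c, x) ≤ r) ≤ |B_r| / |B_{2r}| ≤ (r+1)·(n choose r)/(n choose 2r)`.
We prove exactly this chain, with the binomial ratio bounded by the elementary product formula
`(n choose r)(n-2r+1)^r ≤ (n choose 2r)(2r)^r` (so the probability is
`≤ (r+1)·(2r/(n-2r+1))^r`, which for `r ≤ n/128` is `≤ (r+1)·63^{-r}`; the paper instead uses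
`(n/k)^k ≤ (n choose k) ≤ (ne/k)^k` to get `(r+1)(4er/n)^r`). Everything is stated with
cardinalities of `Finset.filter`s of `Finset.univ : Finset (ι → Bool)`; no new definitions.

* `card_filter_hammingDist_le_le` : `|B_r(c)| ≤ Σ_{j ≤ r} (n choose j)`;
* `choose_le_card_filter_hammingDist_le` : `(n choose R) ≤ |B_R(c)|`;
* `sum_range_choose_le` : `Σ_{j ≤ r} (n choose j) ≤ (r+1)(n choose r)` for `2r ≤ n`;
* `choose_mul_pow_le_choose_two_mul` : `(n choose r)(n-2r+1)^r ≤ (n choose 2r)(2r)^r`;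
* `card_near_mul_pow_le` (Lemma 1, counting form): if distinct points of `𝒞` are at distance
  `> 4r` then `|{x | ∃ c ∈ 𝒞, Δ(x,c) ≤ r}|·(n-2r+1)^r ≤ (r+1)·2^n·(2r)^r`.

Mathlib has `hammingDist`/`hammingNorm` and the `Hamming` type synonym but no ball counts
(searched: `hammingBall`, `card_ball`, `hammingSphere` — nothing).

## References

* J. Holmgren, A. S. Wein, *Counterexamples to the low-degree conjecture*, ITCS 2021 (LIPIcs
  185:75) = arXiv:2004.08454, Lemma 1 and its proof (arXiv PDF p. 8; LIPIcs Lemma 14, p. 75:6).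
  Held (`lit read doi-10-4230-lipics-itcs-2021-75 --pages 6`).
* F. J. MacWilliams, N. J. A. Sloane, *The Theory of Error-Correcting Codes* (1977), Ch. 1 §5
  (Hamming balls, sphere packing) — classical; not held.
-/

namespace Literature.InformationTheory.Coding

open Finset

variable {ι : Type*} [Fintype ι] [DecidableEq ι]

/-! ### Binomial coefficients -/

/-- Binomial coefficients increase up to the middle: `j ≤ r ≤ n/2 ⟹ (n choose j) ≤ (n choose r)`.
[folklore] -/
theorem choose_le_choose_of_le_half {n j : ℕ} :
    ∀ {r : ℕ}, j ≤ r → r ≤ n / 2 → n.choose j ≤ n.choose r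
  | 0, hj, _ => by rw [Nat.le_zero.1 hj]
  | r + 1, hj, hr => by
    rcases Nat.lt_or_eq_of_le hj with h | h
    · exact (choose_le_choose_of_le_half (Nat.le_of_lt_succ h) (Nat.le_of_succ_le hr)).trans
        (Nat.choose_le_succ_of_lt_half_left (Nat.lt_of_succ_le hr))
    · rw [h]

/-- `Σ_{j ≤ r} (n choose j) ≤ (r+1)·(n choose r)` when `2r ≤ n` (each term is at most the last).
[cite: HolmgrenWein2021, Lemma 1, proof (arXiv p. 8; LIPIcs Lemma 14: `|B_r| ≤ (r+1)(n choose r)`)] -/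
theorem sum_range_choose_le (n r : ℕ) (hr : 2 * r ≤ n) :
    ∑ j ∈ range (r + 1), n.choose j ≤ (r + 1) * n.choose r := by
  have hr' : r ≤ n / 2 := (Nat.le_div_iff_mul_le Nat.zero_lt_two).2 (by omega)
  calc ∑ j ∈ range (r + 1), n.choose j ≤ ∑ _j ∈ range (r + 1), n.choose r :=
        sum_le_sum fun j hj => choose_le_choose_of_le_half (Nat.lt_succ_iff.1 (mem_range.1 hj)) hr'
    _ = (r + 1) * n.choose r := by rw [sum_const, card_range, smul_eq_mul]

/-- **The binomial ratio `(n choose r)/(n choose 2r)`, product form**: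
`(n choose r)·(n-2r+1)^r ≤ (n choose 2r)·(2r)^r` for `2r ≤ n`. Indeed
`(n choose r)/(n choose 2r) = ((2r)!/r!)/((n-r)!/(n-2r)!) = Π_{j=1}^{r} (r+j)/(n-2r+j)`, and
`(2r).descFactorial r ≤ (2r)^r`, `(n-r).descFactorial r ≥ (n-2r+1)^r`.
[cite: HolmgrenWein2021, Lemma 1, proof (arXiv p. 8; LIPIcs Lemma 14: the bound on `(n choose r)(n choose 2r)⁻¹`)] -/
theorem choose_mul_pow_le_choose_two_mul (n r : ℕ) (h : 2 * r ≤ n) :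
    n.choose r * (n - 2 * r + 1) ^ r ≤ n.choose (2 * r) * (2 * r) ^ r := by
  -- the factorial identity `choose r · desc(n-r, r) = choose 2r · desc(2r, r)`
  have hA := Nat.choose_mul_factorial_mul_factorial (show r ≤ n by omega)
  have hB := Nat.choose_mul_factorial_mul_factorial h
  have hC := Nat.factorial_mul_descFactorial (show r ≤ 2 * r by omega)
  have hD := Nat.factorial_mul_descFactorial (show r ≤ n - r by omega)
  rw [show 2 * r - r = r by omega] at hC
  rw [show n - r - r = n - 2 * r by omega] at hD
  have key : n.choose r * (n - r).descFactorial r = n.choose (2 * r) * (2 * r).descFactorial r := by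
    have hK : 0 < r.factorial * (n - 2 * r).factorial :=
      Nat.mul_pos (Nat.factorial_pos _) (Nat.factorial_pos _)
    refine Nat.eq_of_mul_eq_mul_right hK ?_
    calc n.choose r * (n - r).descFactorial r * (r.factorial * (n - 2 * r).factorial)
        = n.choose r * r.factorial * ((n - 2 * r).factorial * (n - r).descFactorial r) := by ring
      _ = n.factorial := by rw [hD, hA]
      _ = n.choose (2 * r) * (r.factorial * (2 * r).descFactorial r) * (n - 2 * r).factorial := by
          rw [hC, hB]
      _ = n.choose (2 * r) * (2 * r).descFactorial r * (r.factorial * (n - 2 * r).factorial) := by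
          ring
  calc n.choose r * (n - 2 * r + 1) ^ r ≤ n.choose r * (n - r).descFactorial r := by
        refine Nat.mul_le_mul_left _ ?_
        have := Nat.pow_sub_le_descFactorial (n - r) r
        rwa [show n - r + 1 - r = n - 2 * r + 1 by omega] at this
    _ = n.choose (2 * r) * (2 * r).descFactorial r := key
    _ ≤ n.choose (2 * r) * (2 * r) ^ r := Nat.mul_le_mul_left _ (Nat.descFactorial_le_pow _ _)

/-! ### Hamming balls in `{0,1}^ι` -/

omit [DecidableEq ι] in
/-- The Hamming distance to `c` is the size of the mismatch set. [folklore] -/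
theorem hammingDist_eq_card_mismatch (x c : ι → Bool) :
    hammingDist x c = #{i | x i ≠ c i} := rfl

omit [Fintype ι] in
/-- Two Boolean strings with the same mismatch set against `c` are equal. [folklore] -/
theorem eq_of_mismatch_eq {x x' c : ι → Bool} (s : Finset ι) (hx : ∀ i, i ∈ s ↔ x i ≠ c i)
    (hx' : ∀ i, i ∈ s ↔ x' i ≠ c i) : x = x' := by
  funext i
  have h1 := hx i
  have h2 := hx' i
  revert h1 h2
  cases x i <;> cases x' i <;> cases c i <;> simp

/-- **Upper bound on a Hamming ball**: `|B_r(c)| ≤ Σ_{j ≤ r} (n choose j)` (the mismatch set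
`x ↦ {i | xᵢ ≠ cᵢ}` is injective and has at most `r` elements).
[cite: HolmgrenWein2021, Lemma 1, proof (arXiv p. 8; LIPIcs Lemma 14: bounds on `|B_r|`)] -/
theorem card_filter_hammingDist_le_le (c : ι → Bool) (r : ℕ) :
    #{x : ι → Bool | hammingDist x c ≤ r} ≤ ∑ j ∈ range (r + 1), (Fintype.card ι).choose j := by
  let D : (ι → Bool) → Finset ι := fun x => univ.filter fun i => x i ≠ c i
  have hD : ∀ x, hammingDist x c = (D x).card := fun x => rfl
  have hinj : Function.Injective D := fun x x' h =>
    eq_of_mismatch_eq (c := c) (D x) (fun i => by simp [D]) (fun i => by rw [h]; simp [D])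
  calc #{x : ι → Bool | hammingDist x c ≤ r}
      = #((univ.filter fun x : ι → Bool => hammingDist x c ≤ r).image D) :=
        (card_image_of_injective _ hinj).symm
    _ ≤ #((range (r + 1)).biUnion fun j => powersetCard j (univ : Finset ι)) := by
        refine card_le_card fun s hs => ?_
        obtain ⟨x, hx, rfl⟩ := mem_image.1 hs
        simp only [mem_filter, mem_univ, true_and] at hx
        exact mem_biUnion.2 ⟨(D x).card, mem_range.2 (Nat.lt_succ_of_le (hD x ▸ hx)),
          mem_powersetCard.2 ⟨subset_univ _, rfl⟩⟩
    _ ≤ ∑ j ∈ range (r + 1), #(powersetCard j (univ : Finset ι)) := card_biUnion_le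
    _ = ∑ j ∈ range (r + 1), (Fintype.card ι).choose j := by
        simp_rw [card_powersetCard, card_univ]

/-- **Lower bound on a Hamming ball**: `(n choose R) ≤ |B_R(c)|` (flip `c` on any `R`-set).
[cite: HolmgrenWein2021, Lemma 1, proof (arXiv p. 8; LIPIcs Lemma 14: bounds on `|B_r|`)] -/
theorem choose_le_card_filter_hammingDist_le (c : ι → Bool) (R : ℕ) :
    (Fintype.card ι).choose R ≤ #{x : ι → Bool | hammingDist x c ≤ R} := by
  let flip : Finset ι → ι → Bool := fun s i => if i ∈ s then !c i else c i
  have hmis : ∀ s : Finset ι, ∀ i, i ∈ s ↔ flip s i ≠ c i := fun s i => by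
    by_cases h : i ∈ s <;> simp [flip, h]
  have hdist : ∀ s : Finset ι, hammingDist (flip s) c = s.card := fun s => by
    rw [hammingDist_eq_card_mismatch]
    congr 1
    ext i
    simp [(hmis s i).symm]
  rw [← card_univ, ← card_powersetCard]
  refine card_le_card_of_injOn flip (fun s hs => ?_) fun s hs s' hs' h => ?_
  · rw [mem_coe, mem_filter]
    exact ⟨mem_univ _, (hdist s).trans_le (mem_powersetCard.1 hs).2.le⟩
  · ext i
    rw [hmis s i, hmis s' i, h]

/-- **Holmgren–Wein Lemma 1, counting form.** If distinct points of `𝒞 ⊆ {0,1}^n` are at Hamming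
distance `> 4r` (so the radius-`2r` balls around them are pairwise disjoint, as when `𝒞` is a
code uniquely decodable from `2r` errors), then the set of strings within distance `r` of `𝒞`
satisfies `|{x | ∃ c ∈ 𝒞, Δ(x, c) ≤ r}| · (n - 2r + 1)^r ≤ (r + 1) · 2ⁿ · (2r)^r`, i.e. a uniformly
random string is within distance `r` of `𝒞` with probability `≤ (r+1)·(2r/(n-2r+1))^r`. Proof as
printed: union bound `≤ |𝒞|·|B_r|`, packing `|𝒞|·|B_{2r}| ≤ 2ⁿ`, and the ball bounds above.
[cite: HolmgrenWein2021, Lemma 1 (arXiv p. 8; LIPIcs Lemma 14, p. 75:6)] -/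
theorem card_near_mul_pow_le (𝒞 : Finset (ι → Bool)) (r : ℕ) (h2r : 2 * r ≤ Fintype.card ι)
    (hsep : ∀ c ∈ 𝒞, ∀ c' ∈ 𝒞, c ≠ c' → 4 * r < hammingDist c c') :
    #{x : ι → Bool | ∃ c ∈ 𝒞, hammingDist x c ≤ r} * (Fintype.card ι - 2 * r + 1) ^ r ≤
      (r + 1) * 2 ^ Fintype.card ι * (2 * r) ^ r := by
  set n := Fintype.card ι with hn
  -- union bound
  have hU : #{x : ι → Bool | ∃ c ∈ 𝒞, hammingDist x c ≤ r} ≤ #𝒞 * ((r + 1) * n.choose r) := by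
    calc #{x : ι → Bool | ∃ c ∈ 𝒞, hammingDist x c ≤ r}
        ≤ #(𝒞.biUnion fun c => univ.filter fun x : ι → Bool => hammingDist x c ≤ r) := by
          refine card_le_card fun x hx => ?_
          simp only [mem_filter, mem_univ, true_and] at hx
          obtain ⟨c, hc, hxc⟩ := hx
          exact mem_biUnion.2 ⟨c, hc, by simpa using hxc⟩
      _ ≤ ∑ c ∈ 𝒞, #{x : ι → Bool | hammingDist x c ≤ r} := card_biUnion_le
      _ ≤ ∑ _c ∈ 𝒞, (r + 1) * n.choose r :=
          sum_le_sum fun c _ => (card_filter_hammingDist_le_le c r).trans (sum_range_choose_le n r h2r)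
      _ = #𝒞 * ((r + 1) * n.choose r) := by rw [sum_const, smul_eq_mul]
  -- packing bound
  have hP : #𝒞 * n.choose (2 * r) ≤ 2 ^ n := by
    have hdisj : (𝒞 : Set (ι → Bool)).PairwiseDisjoint
        fun c => univ.filter fun x : ι → Bool => hammingDist x c ≤ 2 * r := by
      intro c hc c' hc' hne
      refine disjoint_left.2 fun x hx hx' => ?_
      simp only [mem_filter, mem_univ, true_and] at hx hx'
      have := hsep c hc c' hc' hne
      have htri := hammingDist_triangle c x c'
      rw [hammingDist_comm c x] at htri
      omega
    calc #𝒞 * n.choose (2 * r) = ∑ _c ∈ 𝒞, n.choose (2 * r) := by rw [sum_const, smul_eq_mul]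
      _ ≤ ∑ c ∈ 𝒞, #{x : ι → Bool | hammingDist x c ≤ 2 * r} :=
          sum_le_sum fun c _ => choose_le_card_filter_hammingDist_le c (2 * r)
      _ = #(𝒞.biUnion fun c => univ.filter fun x : ι → Bool => hammingDist x c ≤ 2 * r) :=
          (card_biUnion hdisj).symm
      _ ≤ #(univ : Finset (ι → Bool)) := card_le_univ _
      _ = 2 ^ n := by rw [card_univ, Fintype.card_fun, Fintype.card_bool]
  -- combine through the binomial ratio
  have hpos : 0 < n.choose (2 * r) := Nat.choose_pos h2r
  refine Nat.le_of_mul_le_mul_right ?_ hpos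
  calc #{x : ι → Bool | ∃ c ∈ 𝒞, hammingDist x c ≤ r} * (n - 2 * r + 1) ^ r * n.choose (2 * r)
      ≤ #𝒞 * ((r + 1) * n.choose r) * (n - 2 * r + 1) ^ r * n.choose (2 * r) :=
        Nat.mul_le_mul_right _ (Nat.mul_le_mul_right _ hU)
    _ = (r + 1) * (n.choose r * (n - 2 * r + 1) ^ r) * (#𝒞 * n.choose (2 * r)) := by ring
    _ ≤ (r + 1) * (n.choose (2 * r) * (2 * r) ^ r) * 2 ^ n :=
        Nat.mul_le_mul (Nat.mul_le_mul_left _ (choose_mul_pow_le_choose_two_mul n r h2r)) hP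
    _ = (r + 1) * 2 ^ n * (2 * r) ^ r * n.choose (2 * r) := by ring

end Literature.InformationTheory.Coding
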